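import Literature.NumberTheory.EllipticCurves.BSDSelmerSmithDecomposition
import Literature.NumberTheory.EllipticCurves.TwoTorsionCardProofs
import HarnessLib

/-!
# Smith's branch (1) in coefficients: `E(ℚ)[2] = 0` iff the `2`-division cubic has no rational
# root — Smith's `2^∞`-Selmer law for such curves from the refereed part I

A `…Proofs` companion (theorems only; no definitions, no named facts) of `BSDSelmerSmithCases`
(`ratTwoTorsionCard`, Smith's Def. 1.6), `BSDSelmerSmithAssumption` ([Smi22a] Assumption 1.1,
`smi22aAssumption`) and `BSDSelmerSmithDecomposition` (`smith2022_selmerCorank_distribution` =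
[Smi22a] Thm. 1.2), in the spirit of `BSDSelmerSmithCaseIICoefficientsProofs` (which decides
branch (2) / Case II for `y² = x(x² + ax + b)`): here **branch (1), `A(ℚ)[2] = 0`, is made
decidable on an arbitrary Weierstrass model**.

* §1 **`#E(ℚ)[2] = 1` iff the `2`-division cubic `4x³ + b₂x² + 2b₄x + b₆` (Mathlib's
  `WeierstrassCurve.twoTorsionPolynomial`) has no rational root**
  (`ratTwoTorsionCard_eq_one_iff_forall_not_isRoot`; for `a₁ = a₃ = 0` the cubic is
  `4(x³ + a₂x² + a₄x + a₆)`, `ratTwoTorsionCard_eq_one_iff_of_a₁_a₃`). "⟸" needs no smoothness: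
  a non-zero `Γ_ℚ`-fixed point of `E[2]` descends to `E(ℚ)` (tree `fixedPoints_eq_range_map_holds`)
  and its abscissa is a root (tree `isRoot_twoTorsionPolynomial_of_add_self_eq_zero`); "⟹" (for
  `E` elliptic): a root `x₀` gives the rational point `(x₀, -(a₁x₀ + a₃)/2) = -(itself)`.
  Silverman, *AEC*, III.2.3 and Ex. 3.7 (`ψ₂ = 2y + a₁x + a₃`, `ψ₂² = 4x³ + b₂x² + 2b₄x + b₆`);
  Silverman–Tate, Thm. 2.1(a).
* §2 `E(ℚ)[2] = 0` is invariant under quadratic twists (`x ↦ dx` on the cubics), hence depends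
  only on `j(E)` when `j ≠ 0, 1728` (`ratTwoTorsionCard_eq_one_of_j_eq`, via the tree's
  `exists_variableChange_eq_quadraticTwist_of_j_eq'` and `ratTwoTorsionCard_smul`).
* §3 **Smith.** Such curves satisfy [Smi22a] Assumption 1.1 (1) and are in Case I of
  arXiv:2503.17619, Def. 1.6; hence **Smith's `1/2, 1/2, 0` law for the `2^∞`-Selmer coranks of
  their quadratic twists (`smith_selmerCorank_density`) follows from the REFEREED part I alone**
  (A. Smith, J. Amer. Math. Soc. 39 (2026) 1–72, Thm. 1.2, first case — proved there from
  Thm. 1.5: "we derive the first and third cases of Theorem 1.2 as a consequence", p. 4), with no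
  appeal to part II, to the preprint arXiv:2503.17619, to Modularity or to Monsky. (PROVENANCE
  versus FORMAL DEPENDENCY, referee note GAP-C: "part I alone" describes where the INSTANCE used
  here — branch (1) of Assumption 1.1 — is proved in print; formally every theorem of §3 consumes
  the single named fact `h22 = smith2022_selmerCorank_distribution`, i.e. [Smi22a] Thm. 1.2 as
  STATED for all three branches of Assumption 1.1, whose branch (2) is proved in part II —
  J. Amer. Math. Soc. 39 (2026) 453–514; both parts are refereed, so no print-strength gap.)
  Entry points:
  (`smith_selmerCorank_density_of_ratTwoTorsionCard_eq_one`, `…_of_forall_not_isRoot`,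
  `…_of_j_eq_of_ratTwoTorsionCard_eq_one`). By [Duke97] (quoted in [Smi22a], p. 3: "most elliptic
  curves over `ℚ` satisfy `A(ℚ)_tor = 0` and hence satisfy this assumption") this is the generic
  case.
* The sibling file `BSDSelmerSmithNoRationalTwoTorsionCMProofs` applies this in coefficients: a
  model with `a₁ = 0`, `a₂, a₄, a₆ ∈ ℤ` and `a₃` odd has `E(ℚ)[2] = 0` (this covers the tree's CM
  curves `cm11, cm19, cm43, cm67, cm163`, `2` inert), and `y² = x³ + k` has `E(ℚ)[2] = 0` iff
  `-k ∉ ℚ³`.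

Design note: the group law on `W.toAffine.Point` over `ℚ` is never used (Mathlib's instance takes
a `DecidableEq ℚ` argument, and the tree's lemmas are elaborated with the classical one); all
point computations happen in `E(ℚ̄) = geomPoints W`, and rational points enter only through
`toGeomPoints` / Galois descent (`exists_toGeomPoints_eq_of_forall_smul_eq`).

Motivation (cell `bsd-goldfeld`, variant (α) of the brief): together with
`smith_selmerCorank_density_cm7_of_smith2022` (branch (2), `X₀(49)`, `2` split in `ℚ(√-7)`) this
puts the Smith input of the CM Goldfeld assemblies on refereed print for the `2`-inert
class-number-one CM curves as well.

## References

* [Smith2022SelmerTwistI] A. Smith, *The distribution of `ℓ^∞`-Selmer groups in degree `ℓ` twist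
  families I*, J. Amer. Math. Soc. 39 (2026), no. 1, 1–72 (arXiv:2207.05674): Assumption 1.1 (1),
  Thm. 1.2, Thm. 1.5 and the sentence after it (arXiv p. 3–4).
* [arXiv250317619] A. Smith, arXiv:2503.17619 (2025): Def. 1.6 (Case I).
* [SilvermanAEC2009] J. H. Silverman, *AEC*, 2nd ed.: III.2.3, Exercise 3.7, VIII.§1, X.5.4.
* [SilvermanTate2015] J. H. Silverman, J. T. Tate, *Rational Points on Elliptic Curves*, 2nd ed.
  (2015), §2.1, Thm. 2.1(a) (points of order two of `y² = f(x)` are the `(α, 0)`, `f(α) = 0`).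
-/

noncomputable section

open scoped Classical

open Polynomial

namespace Literature.NumberTheory.EllipticCurves

open WeierstrassCurve

/-! ## §1 `E(ℚ)[2] = 0` iff `4x³ + b₂x² + 2b₄x + b₆` has no rational root -/

section Criterion

variable (W : WeierstrassCurve ℚ)

/-- `#E(ℚ)[2] = 1` iff `O` is the only `Γ_ℚ`-fixed point of `E[2]` (the fixed points always
contain `O`). [folklore] -/
private theorem ratTwoTorsionCard_eq_one_iff_forall_eq_zero :
    ratTwoTorsionCard W = 1 ↔
      ∀ Q : geomTorsion W (2 : ℤ), (∀ σ : Field.absoluteGaloisGroup ℚ, σ • Q = Q) → Q = 0 := by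
  rw [ratTwoTorsionCard, Nat.card_eq_one_iff_exists]
  constructor
  · rintro ⟨Q₀, hQ₀⟩ Q hQ
    have h1 := hQ₀ ⟨Q, hQ⟩
    have h0 := hQ₀ ⟨0, fun σ ↦ smul_zero σ⟩
    exact congrArg Subtype.val (h1.trans h0.symm)
  · intro h
    exact ⟨⟨0, fun σ ↦ smul_zero σ⟩, fun Q ↦ Subtype.ext (h Q.1 Q.2)⟩

/-- The `2`-division cubic evaluated: `x` is a root of `W.twoTorsionPolynomial` iff
`4x³ + b₂x² + 2b₄x + b₆ = 0` (the cubic of Silverman, *AEC*, III.1, `y² = 4x³ + b₂x² + 2b₄x + b₆`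
after completing the square; `= ψ₂²`, Ex. 3.7(b)).
[cite: SilvermanAEC2009, III.1 (the equation `y² = 4x³ + b₂x² + 2b₄x + b₆`) and Exercise 3.7(b)] -/
theorem isRoot_twoTorsionPolynomial_iff {F : Type*} [Field F] (V : WeierstrassCurve F) (x : F) :
    V.twoTorsionPolynomial.toPoly.IsRoot x ↔
      4 * x ^ 3 + V.b₂ * x ^ 2 + 2 * V.b₄ * x + V.b₆ = 0 := by
  simp only [twoTorsionPolynomial, Cubic.toPoly, IsRoot.def, eval_add, eval_mul, eval_C, eval_pow,
    eval_X]

/-- The `2`-division cubic of `E/ℚ̄` at a rational argument is the rational cubic: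
`4x³ + b₂x² + 2b₄x + b₆ = 0` in `ℚ̄` (coefficients of `E ⊗ ℚ̄`) iff the same holds in `ℚ`.
[folklore] -/
private theorem twoTorsionCubic_baseChange_eq_zero_iff (x : ℚ) :
    4 * (algebraMap ℚ (AlgebraicClosure ℚ) x) ^ 3 +
        (W.baseChange (AlgebraicClosure ℚ)).b₂ * (algebraMap ℚ (AlgebraicClosure ℚ) x) ^ 2 +
        2 * (W.baseChange (AlgebraicClosure ℚ)).b₄ * (algebraMap ℚ (AlgebraicClosure ℚ) x) +
        (W.baseChange (AlgebraicClosure ℚ)).b₆ = 0 ↔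
      4 * x ^ 3 + W.b₂ * x ^ 2 + 2 * W.b₄ * x + W.b₆ = 0 := by
  have e : 4 * (algebraMap ℚ (AlgebraicClosure ℚ) x) ^ 3 +
        (W.baseChange (AlgebraicClosure ℚ)).b₂ * (algebraMap ℚ (AlgebraicClosure ℚ) x) ^ 2 +
        2 * (W.baseChange (AlgebraicClosure ℚ)).b₄ * (algebraMap ℚ (AlgebraicClosure ℚ) x) +
        (W.baseChange (AlgebraicClosure ℚ)).b₆ =
      algebraMap ℚ (AlgebraicClosure ℚ) (4 * x ^ 3 + W.b₂ * x ^ 2 + 2 * W.b₄ * x + W.b₆) := by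
    simp only [baseChange, map_b₂, map_b₄, map_b₆, map_add, map_mul, map_pow, map_ofNat]
  rw [e, map_eq_zero_iff _ (algebraMap ℚ (AlgebraicClosure ℚ)).injective]

/-- **A rational `2`-torsion point gives a rational root of the `2`-division cubic.** If
`#E(ℚ)[2] ≠ 1` there is a non-zero `Γ_ℚ`-fixed `Q ∈ E[2]`; by Galois descent
(`E(ℚ̄)^{Γ_ℚ} = E(ℚ)`, tree `fixedPoints_eq_range_map_holds`) `Q = (x, y)` with `x, y ∈ ℚ`, and
`2Q = O` makes `x` a root of `4x³ + b₂x² + 2b₄x + b₆` (`isRoot_twoTorsionPolynomial_of_add_self_eq_zero`).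
Silverman, *AEC*, III.2.3 (`-P = (x, -y - a₁x - a₃)`) with Ex. 3.7 (`ψ₂ = 2y + a₁x + a₃`,
`ψ₂² = 4x³ + b₂x² + 2b₄x + b₆`), VIII.§1.
[cite: SilvermanAEC2009, III.2.3 and Exercise 3.7(b); VIII.§1 (proof of Prop. 1.2)] -/
theorem exists_isRoot_twoTorsionPolynomial_of_ratTwoTorsionCard_ne_one
    (h : ratTwoTorsionCard W ≠ 1) : ∃ x : ℚ, W.twoTorsionPolynomial.toPoly.IsRoot x := by
  rw [Ne, ratTwoTorsionCard_eq_one_iff_forall_eq_zero] at h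
  push Not at h
  obtain ⟨Q, hQ, hQ0⟩ := h
  set L := AlgebraicClosure ℚ with hL
  set ι := algebraMap ℚ L with hι
  have hfix : ∀ σ : Field.absoluteGaloisGroup ℚ, σ • (Q : W.geomPoints) = Q := fun σ ↦ by
    rw [← AddSubgroup.torsionBy.coe_smul, hQ σ]
  have h2 : (Q : W.geomPoints) + Q = 0 := by
    rw [← two_zsmul]
    exact (mem_geomTorsion_iff W 2 _).mp Q.2
  -- Galois descent: `Q` comes from `E(ℚ)`
  obtain ⟨P, hP⟩ := exists_toGeomPoints_eq_of_forall_smul_eq W hfix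
  rcases P with _ | ⟨x, y, hxy⟩
  · exfalso
    apply hQ0
    apply Subtype.ext
    rw [← hP]
    rfl
  · have e' : ∃ h', (Q : W.geomPoints) = Affine.Point.some (ι x) (ι y) h' := ⟨_, hP.symm⟩
    obtain ⟨h', e'⟩ := e'
    rw [e'] at h2
    have hroot := ((W.baseChange L).isRoot_twoTorsionPolynomial_of_add_self_eq_zero h2).2
    rw [isRoot_twoTorsionPolynomial_iff, twoTorsionCubic_baseChange_eq_zero_iff] at hroot
    exact ⟨x, (isRoot_twoTorsionPolynomial_iff W x).mpr hroot⟩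

/-- **No rational root of the `2`-division cubic ⟹ `E(ℚ)[2] = 0`** (`#E(ℚ)[2] = 1`).
[cite: SilvermanAEC2009, III.2.3 and Exercise 3.7(b)]
[cite: SilvermanTate2015, §2.1, Thm. 2.1(a)] -/
theorem ratTwoTorsionCard_eq_one_of_forall_not_isRoot
    (h : ∀ x : ℚ, ¬ W.twoTorsionPolynomial.toPoly.IsRoot x) : ratTwoTorsionCard W = 1 := by
  by_contra h1
  obtain ⟨x, hx⟩ := exists_isRoot_twoTorsionPolynomial_of_ratTwoTorsionCard_ne_one W h1
  exact h x hx

/-- **A rational root of the `2`-division cubic gives a rational point of order `2`**: for an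
elliptic `E/ℚ` and `x₀ ∈ ℚ` with `4x₀³ + b₂x₀² + 2b₄x₀ + b₆ = 0`, the point
`P₀ = (x₀, -(a₁x₀ + a₃)/2)` lies on `E` (`(2y + a₁x + a₃)² - (4x³ + b₂x² + 2b₄x + b₆)` is `4`
times the Weierstrass equation), is non-singular (`E` is smooth) and satisfies `P₀ = -P₀`; its
image in `E(ℚ̄)` is a non-zero `Γ_ℚ`-fixed point of `E[2]`, so `#E(ℚ)[2] ≠ 1`.
[cite: SilvermanAEC2009, III.2.3 and Exercise 3.7(b)]
[cite: SilvermanTate2015, §2.1, Thm. 2.1(a)] -/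
theorem ratTwoTorsionCard_ne_one_of_isRoot [W.IsElliptic] {x₀ : ℚ}
    (hx : W.twoTorsionPolynomial.toPoly.IsRoot x₀) : ratTwoTorsionCard W ≠ 1 := by
  rw [isRoot_twoTorsionPolynomial_iff] at hx
  set L := AlgebraicClosure ℚ with hL
  set ι := algebraMap ℚ L with hι
  set y₀ : ℚ := -(W.a₁ * x₀ + W.a₃) / 2 with hy₀
  have hψ : 2 * y₀ + W.a₁ * x₀ + W.a₃ = 0 := by rw [hy₀]; ring
  have heq : W.toAffine.Equation x₀ y₀ := by
    rw [Affine.equation_iff]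
    simp only [b₂, b₄, b₆] at hx
    linear_combination (1 / 4 : ℚ) * (2 * y₀ + W.a₁ * x₀ + W.a₃) * hψ - (1 / 4 : ℚ) * hx
  have hns : W.toAffine.Nonsingular x₀ y₀ := (Affine.equation_iff_nonsingular).mp heq
  -- the rational point `P₀ = (x₀, y₀)` and its image `G` in `E(ℚ̄)`
  set P₀ : W.toAffine.Point := .some x₀ y₀ hns with hP₀
  set G : W.geomPoints := toGeomPoints W P₀ with hG
  have eG : ∃ h', G = Affine.Point.some (ι x₀) (ι y₀) h' := ⟨_, rfl⟩
  obtain ⟨h', eG⟩ := eG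
  have hneg : ι y₀ = (W.baseChange L).toAffine.negY (ι x₀) (ι y₀) := by
    have e := congrArg ι hψ
    simp only [map_add, map_mul, map_ofNat, map_zero] at e
    rw [Affine.negY, baseChange, map_a₁, map_a₃, ← hι]
    linear_combination e
  have h2 : G + G = 0 := by
    rw [eG]
    exact Affine.Point.add_self_of_Y_eq hneg
  have hG0 : G ≠ 0 := by
    rw [eG]
    exact Affine.Point.some_ne_zero _
  have hmem : G ∈ geomTorsion W (2 : ℤ) := by
    rw [mem_geomTorsion_iff, two_zsmul, h2]
  have hfix : ∀ σ : Field.absoluteGaloisGroup ℚ, σ • G = G := fun σ ↦ smul_toGeomPoints W σ P₀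
  rw [Ne, ratTwoTorsionCard_eq_one_iff_forall_eq_zero]
  intro hall
  have h0 := hall ⟨G, hmem⟩ (fun σ ↦ Subtype.ext (by
    rw [AddSubgroup.torsionBy.coe_smul]; exact hfix σ))
  exact hG0 (congrArg Subtype.val h0)

/-- **`E(ℚ)[2] = 0` iff the `2`-division cubic `4x³ + b₂x² + 2b₄x + b₆` has no rational root**
(for an elliptic `E/ℚ`; the non-zero `2`-torsion points are the `(x, y)` with `x` a root and
`2y + a₁x + a₃ = 0`). Silverman, *AEC*, III.2.3 and Ex. 3.7; Silverman–Tate, Thm. 2.1(a) ("a point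
`P = (x, y) ≠ O` on `y² = f(x)` has order two iff `y = 0`").
[cite: SilvermanAEC2009, III.2.3 and Exercise 3.7(b)] [cite: SilvermanTate2015, §2.1, Thm. 2.1(a)] -/
theorem ratTwoTorsionCard_eq_one_iff_forall_not_isRoot [W.IsElliptic] :
    ratTwoTorsionCard W = 1 ↔ ∀ x : ℚ, ¬ W.twoTorsionPolynomial.toPoly.IsRoot x :=
  ⟨fun h _ hx ↦ ratTwoTorsionCard_ne_one_of_isRoot W hx h,
    ratTwoTorsionCard_eq_one_of_forall_not_isRoot W⟩

/-- Explicit form: `E(ℚ)[2] = 0` iff `4x³ + b₂x² + 2b₄x + b₆ ≠ 0` for all `x ∈ ℚ`.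
[cite: SilvermanAEC2009, III.2.3 and Exercise 3.7(b)] -/
theorem ratTwoTorsionCard_eq_one_iff_forall_ne_zero [W.IsElliptic] :
    ratTwoTorsionCard W = 1 ↔
      ∀ x : ℚ, 4 * x ^ 3 + W.b₂ * x ^ 2 + 2 * W.b₄ * x + W.b₆ ≠ 0 := by
  simp only [ratTwoTorsionCard_eq_one_iff_forall_not_isRoot, isRoot_twoTorsionPolynomial_iff, ne_eq]

/-- For a model with `a₁ = a₃ = 0` (`y² = x³ + a₂x² + a₄x + a₆`) the `2`-division cubic is
`4(x³ + a₂x² + a₄x + a₆)`: `E(ℚ)[2] = 0` iff `x³ + a₂x² + a₄x + a₆` has no rational root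
(Silverman–Tate, Thm. 2.1(a): the points of order two of `y² = f(x)` are the `(α, 0)`, `f(α) = 0`).
[cite: SilvermanTate2015, §2.1, Thm. 2.1(a)] -/
theorem ratTwoTorsionCard_eq_one_iff_of_a₁_a₃ [W.IsElliptic] (h₁ : W.a₁ = 0) (h₃ : W.a₃ = 0) :
    ratTwoTorsionCard W = 1 ↔ ∀ x : ℚ, x ^ 3 + W.a₂ * x ^ 2 + W.a₄ * x + W.a₆ ≠ 0 := by
  rw [ratTwoTorsionCard_eq_one_iff_forall_ne_zero]
  refine forall_congr' fun x ↦ ?_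
  rw [b₂, b₄, b₆, h₁, h₃]
  constructor
  · intro h h0
    exact h (by linear_combination (4 : ℚ) * h0)
  · intro h h0
    exact h (by linear_combination (1 / 4 : ℚ) * h0)

end Criterion

/-! ## §2 `E(ℚ)[2] = 0` is invariant under quadratic twists, hence depends only on `j ≠ 0, 1728` -/

section Twist

variable (W : WeierstrassCurve ℚ)

/-- The `2`-division cubic of the quadratic twist `E^d` (`b₂ ↦ d b₂`, `b₄ ↦ d² b₄`, `b₆ ↦ d³ b₆`)
at `d x` is `d³` times that of `E` at `x`. [folklore] -/
private theorem twoTorsionCubic_quadraticTwist (d x : ℚ) :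
    4 * (d * x) ^ 3 + (W.quadraticTwist d).b₂ * (d * x) ^ 2 +
        2 * (W.quadraticTwist d).b₄ * (d * x) + (W.quadraticTwist d).b₆ =
      d ^ 3 * (4 * x ^ 3 + W.b₂ * x ^ 2 + 2 * W.b₄ * x + W.b₆) := by
  rw [quadraticTwist_b₂, quadraticTwist_b₄, quadraticTwist_b₆]
  ring

/-- For `d ≠ 0`, the `2`-division cubic of `E^d` has a rational root iff that of `E` does
(`x ↦ x/d`). [folklore] -/
private theorem exists_twoTorsionCubic_eq_zero_quadraticTwist_iff {d : ℚ} (hd : d ≠ 0) :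
    (∃ x : ℚ, 4 * x ^ 3 + (W.quadraticTwist d).b₂ * x ^ 2 + 2 * (W.quadraticTwist d).b₄ * x +
        (W.quadraticTwist d).b₆ = 0) ↔
      ∃ x : ℚ, 4 * x ^ 3 + W.b₂ * x ^ 2 + 2 * W.b₄ * x + W.b₆ = 0 := by
  constructor
  · rintro ⟨x, hx⟩
    refine ⟨x / d, ?_⟩
    have e := twoTorsionCubic_quadraticTwist W d (x / d)
    rw [mul_div_cancel₀ x hd, hx] at e
    exact (mul_eq_zero.mp e.symm).resolve_left (pow_ne_zero 3 hd)
  · rintro ⟨x, hx⟩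
    exact ⟨d * x, by rw [twoTorsionCubic_quadraticTwist, hx, mul_zero]⟩

/-- **`E^d(ℚ)[2] = 0 ⟺ E(ℚ)[2] = 0`** (`d ≠ 0`): `E[2]` and `E^d[2]` are isomorphic Galois
modules (in coordinates: the `2`-division cubics correspond under `x ↦ d x`).
[cite: SilvermanAEC2009, X.5 Prop. 5.4 (n = 2 for j ≠ 0, 1728: quadratic twists) with III.2.3 and Exercise 3.7(b)] -/
theorem ratTwoTorsionCard_quadraticTwist_eq_one_iff [W.IsElliptic] {d : ℚ} (hd : d ≠ 0) :
    ratTwoTorsionCard (W.quadraticTwist d) = 1 ↔ ratTwoTorsionCard W = 1 := by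
  haveI := W.isElliptic_quadraticTwist hd
  rw [ratTwoTorsionCard_eq_one_iff_forall_ne_zero, ratTwoTorsionCard_eq_one_iff_forall_ne_zero]
  have h := exists_twoTorsionCubic_eq_zero_quadraticTwist_iff W hd
  constructor
  · intro hall x hx
    obtain ⟨x', hx'⟩ := h.mpr ⟨x, hx⟩
    exact hall x' hx'
  · intro hall x hx
    obtain ⟨x', hx'⟩ := h.mp ⟨x, hx⟩
    exact hall x' hx'

/-- **`E(ℚ)[2] = 0` depends only on `j(E) ∉ {0, 1728}`**: two elliptic curves over `ℚ` with the
same `j ≠ 0, 1728` are quadratic twists of each other up to `ℚ`-isomorphism (Silverman X.5.4;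
tree `exists_variableChange_eq_quadraticTwist_of_j_eq'`), and `#E(ℚ)[2]` is invariant under
both (`ratTwoTorsionCard_smul`, `ratTwoTorsionCard_quadraticTwist_eq_one_iff`).
[cite: SilvermanAEC2009, X.5 Prop. 5.4 and Cor. 5.4.1] -/
theorem ratTwoTorsionCard_eq_one_of_j_eq {E W : WeierstrassCurve ℚ} [E.IsElliptic]
    [W.IsElliptic] (hE : ratTwoTorsionCard E = 1) (hj : W.j = E.j) (h0 : E.j ≠ 0)
    (h1728 : E.j ≠ 1728) : ratTwoTorsionCard W = 1 := by
  obtain ⟨d, hd, C, hC⟩ := exists_variableChange_eq_quadraticTwist_of_j_eq' (W := W) (E := E) hj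
    (by rw [hj]; exact h0) (by rw [hj]; exact h1728)
  have h := (ratTwoTorsionCard_quadraticTwist_eq_one_iff E hd).mpr hE
  rwa [← hC, ratTwoTorsionCard_smul] at h

end Twist

/-! ## §3 Smith: branch (1) of [Smi22a] Assumption 1.1, Case I, and the `2^∞`-Selmer law -/

section Smith

variable (W : WeierstrassCurve ℚ)

/-- **Branch (1) of [Smi22a], Assumption 1.1 in coefficients**: if `4x³ + b₂x² + 2b₄x + b₆` has
no rational root then `A(ℚ)[2] = 0`, so `A` satisfies A. Smith, J. Amer. Math. Soc. 39 (2026)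
1–72, Assumption 1.1 (1) ("`A(ℚ)[2] = 0`"; "By [Duke97], most elliptic curves over `ℚ` satisfy
`A(ℚ)_tor = 0` and hence satisfy this assumption", p. 3).
[cite: Smith2022SelmerTwistI, Assumption 1.1 (1) (arXiv p. 3)] -/
theorem smi22aAssumption_of_forall_not_isRoot
    (h : ∀ x : ℚ, ¬ W.twoTorsionPolynomial.toPoly.IsRoot x) : smi22aAssumption W :=
  smi22aAssumption_of_ratTwoTorsionCard_eq_one (ratTwoTorsionCard_eq_one_of_forall_not_isRoot W h)

/-- Such a curve is in **Case I** of A. Smith, arXiv:2503.17619, Def. 1.6 ("Either `E(ℚ)[2] = 0`,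
or …"). [cite: arXiv250317619, Def. 1.6 (Case I)] -/
theorem smithCaseI_of_forall_not_isRoot
    (h : ∀ x : ℚ, ¬ W.twoTorsionPolynomial.toPoly.IsRoot x) : smithCaseI W :=
  Or.inl (ratTwoTorsionCard_eq_one_of_forall_not_isRoot W h)

/-- **Smith's `2^∞`-Selmer corank law for a curve with `E(ℚ)[2] = 0`, from the refereed part I
alone.** For an elliptic `E/ℚ` with `#E(ℚ)[2] = 1`, [Smi22a] = J. Amer. Math. Soc. 39 (2026)
1–72, Thm. 1.2 in its first case (proved there from Thm. 1.5: "we derive the first and third cases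
of Theorem 1.2 as a consequence", p. 4) gives the `1/2, 1/2, 0` distribution of the
`2^∞`-Selmer coranks of the twists `E^d` — the tree's `smith_selmerCorank_density E` — with no
appeal to the preprint arXiv:2503.17619 (Cases III–V), to Modularity or to Monsky
(`smith_selmerCorank_density_of_smi22a_printed`).
[cite: Smith2022SelmerTwistI, Thm. 1.2 with Assumption 1.1 (1); Thm. 1.5 and the sentence after it (arXiv p. 4)] -/
theorem smith_selmerCorank_density_of_ratTwoTorsionCard_eq_one
    (h22 : smith2022_selmerCorank_distribution) [W.IsElliptic] (h1 : ratTwoTorsionCard W = 1) :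
    smith_selmerCorank_density W :=
  smith_selmerCorank_density_of_smi22a_printed (fun A _ hA ↦ h22 A hA) W
    (smi22aAssumption_of_ratTwoTorsionCard_eq_one h1)

/-- **Smith's law from [Smi22a] Thm. 1.2 for every elliptic `E/ℚ` whose `2`-division cubic
`4x³ + b₂x² + 2b₄x + b₆` has no rational root.**
[cite: Smith2022SelmerTwistI, Thm. 1.2 with Assumption 1.1 (1)] -/
theorem smith_selmerCorank_density_of_forall_not_isRoot
    (h22 : smith2022_selmerCorank_distribution) [W.IsElliptic]
    (h : ∀ x : ℚ, ¬ W.twoTorsionPolynomial.toPoly.IsRoot x) : smith_selmerCorank_density W :=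
  smith_selmerCorank_density_of_ratTwoTorsionCard_eq_one W h22
    (ratTwoTorsionCard_eq_one_of_forall_not_isRoot W h)

/-- The same for a model `y² = x³ + a₂x² + a₄x + a₆` (`a₁ = a₃ = 0`) whose cubic
`x³ + a₂x² + a₄x + a₆` has no rational root. [cite: Smith2022SelmerTwistI, Thm. 1.2 with Assumption 1.1 (1)]
[cite: SilvermanTate2015, §2.1, Thm. 2.1(a)] -/
theorem smith_selmerCorank_density_of_forall_ne_zero_of_a₁_a₃
    (h22 : smith2022_selmerCorank_distribution) [W.IsElliptic] (h₁ : W.a₁ = 0) (h₃ : W.a₃ = 0)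
    (h : ∀ x : ℚ, x ^ 3 + W.a₂ * x ^ 2 + W.a₄ * x + W.a₆ ≠ 0) : smith_selmerCorank_density W :=
  smith_selmerCorank_density_of_ratTwoTorsionCard_eq_one W h22
    ((ratTwoTorsionCard_eq_one_iff_of_a₁_a₃ W h₁ h₃).mpr h)

/-- **Smith's law along `j`**: if some elliptic `E/ℚ` with `j(E) ∉ {0, 1728}` has
`E(ℚ)[2] = 0`, then every elliptic `W/ℚ` with `j(W) = j(E)` satisfies [Smi22a] Assumption 1.1
(1), and [Smi22a] Thm. 1.2 gives `smith_selmerCorank_density W`.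
[cite: Smith2022SelmerTwistI, Thm. 1.2 with Assumption 1.1 (1)]
[cite: SilvermanAEC2009, X.5 Prop. 5.4] -/
theorem smith_selmerCorank_density_of_j_eq_of_ratTwoTorsionCard_eq_one
    (h22 : smith2022_selmerCorank_distribution) {E W : WeierstrassCurve ℚ} [E.IsElliptic]
    [W.IsElliptic] (hE : ratTwoTorsionCard E = 1) (hj : W.j = E.j) (h0 : E.j ≠ 0)
    (h1728 : E.j ≠ 1728) : smith_selmerCorank_density W :=
  smith_selmerCorank_density_of_ratTwoTorsionCard_eq_one W h22
    (ratTwoTorsionCard_eq_one_of_j_eq hE hj h0 h1728)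

end Smith

end Literature.NumberTheory.EllipticCurves

end
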